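import Literature.AlgebraicGeometry.Morphisms.StalkOfDualNumberRigid
import Literature.RingTheory.CompleteLocalRings.DualNumberPoints
import Literature.AlgebraicGeometry.Deformation.CompatibleObstructionTheories
import Mathlib.AlgebraicGeometry.ResidueField
import HarnessLib

/-!
# The functor of points of a pointed `K`-scheme on local `K`-algebras is `h_{𝒪_{X,x}}`;
# `K[ε]`-points through a rational point are the tangent space `(𝔪_x/𝔪_x²)^∨`

Layer `Literature/AlgebraicGeometry/Deformation`, namespace `Literature.AlgebraicGeometry.Deformation`.  Generic,
consumer-agnostic (any field `K`, any `K`-scheme `F : X → Spec K`, any point `x`); DEFINITIONS WITH BODY (the carriers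
`PointsOverAt` / `LocAlgHomAt`, the equivalences, the functor `pointedSchemeFunctor`) and theorems; no named fact, no
instance, no notation.  Cell `hodgecm-mathlib` (D-0151): node E1 («Yoneda tangent bridge») of `B-plan/F-census/SOCKETS-F.md`
§4 (α)/(γ3), generic half — the JOIN of two halves the tree already holds:

* the SCHEME half ★ `Morphisms/StalkOfDualNumberRigid` §1–§2: points `t : Spec R → X` (`R` local) sending `𝔪_R` to `x`
  ↔ local homomorphisms `𝒪_{X,x} → R` (both round trips, functorial in `R`; Mathlib `Scheme.stalkClosedPointTo`);
* the ALGEBRA half ★ `RingTheory/CompleteLocalRings/DualNumberPoints` (`TangentHom.equivDual`: the `K[ε]`-points of an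
  augmented `K`-algebra `(A, π)` lifting `π` are the dual of `(ker π)/(ker π)²`, [Mazur1997Deformation, §15]) and the
  Schlessinger frame ★ `Deformation/T1Lifting` + `CompatibleObstructionTheories` (`ArtAlg`, `ArtinFunctor`, `h_R =
  ArtinFunctor.points R`, `IsNatural`).

The missing clause was the `K`-STRUCTURE: a point through `x` lies OVER `Spec K` iff its local homomorphism is a
`K`-ALGEBRA map for `K → 𝒪_{X,x}` (`stalkAlgebraMap_comp_locHomAt` / `specPtAt_comp_eq`, two `Spec.map` computations).
With it ([GortzWedhorn2020] (6.4), Prop. 6.7 «`X(k[ε])_x = T_x X = (𝔪_x/𝔪_x²)^∨`»; [Schlessinger1968] §2 «`h_R`»):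

* §2 `pointsOverAtEquiv F x R : PointsOverAt F x R ≃ LocAlgHomAt F x R` — `R`-points of `X` through `x` over `K` ≃ local
  `K`-algebra maps `𝒪_{X,x} → R`, for EVERY local `K`-algebra `R` («the functor of points of `(X, x)` is `h_{𝒪_{X,x}}`»);
* §3 naturality in `R` (`pointsOverAtEquiv_map`) and in pointed `K`-morphisms `g : X → Y` (`pointsOverAtEquiv_push`:
  composition with `𝒪_{Y,g x} → 𝒪_{X,x}`, i.e. the transpose of the cotangent map);
* §4 `augmentation_unique` (a local `K`-algebra has at most one augmentation), `isLocalHom_of_augmentation` (`K`-algebra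
  maps into an augmented local `K`-algebra are local) — pure algebra;
* §5 for a `K`-RATIONAL point (an augmentation `π : 𝒪_{X,x} →ₐ[K] K`, unique by §4): `locAlgHomAtDualNumberEquivTangentHom :
  LocAlgHomAt F x K[ε] ≃ TangentHom π` and **`dualNumberPointsOverAtEquivDual : PointsOverAt F x K[ε] ≃ Module.Dual K
  (CotangentSpace 𝒪_{X,x})`**, with `dualNumberPointsOverAtEquivDual_apply_toCotangent` (value on `s̄` = `ε`-part at `s`);
* §6 `pointedSchemeFunctor F x : ArtinFunctor K` (`A ↦ PointsOverAt F x A` on `Art_K`) and its comparison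
  `pointedSchemeFunctorToPoints` with `ArtinFunctor.points 𝒪_{X,x}`: componentwise BIJECTIVE and NATURAL
  (`pointedSchemeFunctorToPoints_bijective`, `isNatural_pointedSchemeFunctorToPoints`) — so the Schlessinger frame's
  statements about `h_{𝒪_{X,x}}` (★ `ArtinFunctor.pointsTangentEquivCotangentDual`, `TangentSpaceOfPoints`) read on the
  `Art_K`-points of `X` through `x`.

The `K`-algebra structure on `𝒪_{X,x}` is installed LOCALLY (`letI := (stalkAlgebraMap F x).toAlgebra`) by the formula
`(germ ⊤ x) ∘ F.appTop ∘ (ΓSpecIso K)⁻¹` of `HodgeTheory/AbelianVarietyTangentOfDualNumber`; `ofHom_stalkAlgebraMap`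
identifies it with `StalkOfDualNumberRigid`'s `K → 𝒪_{Spec K, F x} → 𝒪_{X,x}`.  Rationality is the DATUM `π` (at a closed
point of a scheme l.f.t. over an algebraically closed `K` it is `residue ≫ residueFieldIsoBase`, ★ `StalkOfDualNumberRigid` §2).

Presearch: [corpus: book:gortz2020 (6.3)–(6.4), Prop. 6.7; Exercise 3.18] «tangent space as `k[ε]`-valued points»;
[Schlessinger1968, §2, (2.6)] «`t_F ≅ t_R`, `h_R`»; [Mazur1997Deformation, §15]; tree `rg` (`fromSpecStalk|stalkClosedPointTo`
in `Deformation/` = 0 files; no scheme-level `≃` onto `TangentHom`/`ArtinFunctor.points`).  Mathlib searched and used: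
`Scheme.stalkClosedPointTo(_comp)`, `Scheme.fromSpecStalk`, `Scheme.Hom.germ_stalkMap`, `Spec.map_injective`,
`Spec_closedPoint`, `TopCat.Presheaf.stalkCongr`/`germ_stalkSpecializes`/`stalk_hom_ext`, `TrivSqZeroExt.fstHom`,
`Ideal.Cotangent.equivOfEq`, `LinearEquiv.dualMap`; Mathlib's `SpecToEquivOfLocalRing` has no base field and no fixed point.
HC_CM is proved only modulo the 7 printed citations until rung 0 closes.

## References

* [GortzWedhorn2020] U. Görtz, T. Wedhorn, *Algebraic Geometry I: Schemes* (2nd ed., Springer 2020): (6.3)–(6.4),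
  Prop. 6.7 (tangent space as `k[ε]`-points), (3.4) and Exercise 3.18 (points with values in local rings).
* [Schlessinger1968] M. Schlessinger, Functors of Artin rings, Trans. AMS 130 (1968): §2, (2.6). [Mazur1997Deformation]
  B. Mazur, *An introduction to the deformation theory of Galois representations* (1997), §15. [Manetti1999DeformationTheoryDGLA]
  M. Manetti, Deformation theory via differential graded Lie algebras (1999), Def. 2.7.
-/

set_option autoImplicit false

noncomputable section
universe u

open CategoryTheory AlgebraicGeometry IsLocalRing Literature.AlgebraicGeometry.Morphisms Literature.RingTheory.CompleteLocalRings

namespace Literature.AlgebraicGeometry.Deformation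

variable {K : Type u} [Field K] {X Y : Scheme.{u}} (F : X ⟶ Spec (.of K)) (x : X)

/-! ## §1 The `K`-algebra structure of a stalk of a `K`-scheme -/

/-- The structure map `K → Γ(Spec K) → Γ(X) → 𝒪_{X,x}` of a `K`-scheme at a point (the formula by which the
tree installs `Algebra K 𝒪_{X,x}` locally, e.g. `HodgeTheory/AbelianVarietyTangentOfDualNumber`).
[cite: GortzWedhorn2020, (3.4) and Exercise 3.18] -/
abbrev stalkAlgebraMap : K →+* X.presheaf.stalk x :=
  (X.presheaf.germ ⊤ x trivial).hom.comp (F.appTop.hom.comp (Scheme.ΓSpecIso (.of K)).inv.hom)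

/-- `stalkAlgebraMap` is the structure map `K → 𝒪_{Spec K, F x} → 𝒪_{X,x}` of
`Morphisms/StalkOfDualNumberRigid` §2. [cite: GortzWedhorn2020, (3.4) and Exercise 3.18] -/
theorem ofHom_stalkAlgebraMap :
    CommRingCat.ofHom (stalkAlgebraMap F x) =
      ((Scheme.ΓSpecIso (.of K)).inv ≫ (Spec (.of K)).presheaf.germ ⊤ (F.base x) trivial) ≫ F.stalkMap x := by
  rw [Category.assoc, Scheme.Hom.germ_stalkMap]
  rfl

/-- `Spec (K → 𝒪_{X,x}) = (Spec 𝒪_{X,x} → X → Spec K)`. [cite: GortzWedhorn2020, (3.4) and Exercise 3.18] -/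
theorem Spec_map_stalkAlgebraMap :
    Spec.map (CommRingCat.ofHom (stalkAlgebraMap F x)) = X.fromSpecStalk x ≫ F := by
  rw [ofHom_stalkAlgebraMap]
  exact Spec_map_strMap F x

/-! ## §2 Points with values in a local `K`-algebra through `x`, over `K` -/

variable (R : Type u) [CommRing R] [IsLocalRing R] [Algebra K R]

/-- The `R`-valued points of the `K`-scheme `X` THROUGH `x` and OVER `K`: morphisms `t : Spec R → X` sending the closed
point to `x` with `t ≫ F = Spec (K → R)`. [cite: GortzWedhorn2020, (6.4) Prop. 6.7 and Exercise 3.18] -/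
def PointsOverAt : Type u :=
  {t : Spec (.of R) ⟶ X // t.base (closedPoint R) = x ∧ t ≫ F = Spec.map (CommRingCat.ofHom (algebraMap K R))}

/-- The LOCAL `K`-algebra homomorphisms `𝒪_{X,x} → R` (`K`-structure of `𝒪_{X,x}` through `stalkAlgebraMap`).
[cite: GortzWedhorn2020, (6.4) Prop. 6.7 and Exercise 3.18] -/
def LocAlgHomAt : Type u :=
  letI := (stalkAlgebraMap F x).toAlgebra
  {φ : X.presheaf.stalk x →ₐ[K] R // IsLocalHom φ.toRingHom}

variable {F x R}

/-- **The `K`-structure clause, forward:** for a point `t` over `K` through `x`, its local homomorphism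
`𝒪_{X,x} → R` is a `K`-algebra map. [cite: GortzWedhorn2020, (6.4) Prop. 6.7 and Exercise 3.18] -/
theorem stalkAlgebraMap_comp_locHomAt (t : Spec (.of R) ⟶ X) (ht : t.base (closedPoint R) = x)
    (hF : t ≫ F = Spec.map (CommRingCat.ofHom (algebraMap K R))) :
    CommRingCat.ofHom (stalkAlgebraMap F x) ≫
        ((X.presheaf.stalkCongr (.of_eq ht)).inv ≫ Scheme.stalkClosedPointTo t) =
      CommRingCat.ofHom (algebraMap K R) := by
  apply Spec.map_injective
  rw [Spec.map_comp, Spec_map_stalkAlgebraMap, ← Category.assoc, specPtAt_locHomAt t ht, hF]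

/-- Pointwise form of `stalkAlgebraMap_comp_locHomAt`. [cite: GortzWedhorn2020, (6.4) Prop. 6.7 and Exercise 3.18] -/
theorem locHomAt_stalkAlgebraMap (t : Spec (.of R) ⟶ X) (ht : t.base (closedPoint R) = x)
    (hF : t ≫ F = Spec.map (CommRingCat.ofHom (algebraMap K R))) (c : K) :
    ((X.presheaf.stalkCongr (.of_eq ht)).inv ≫ Scheme.stalkClosedPointTo t) (stalkAlgebraMap F x c) =
      algebraMap K R c := by
  have h := congrArg (fun f => (CommRingCat.Hom.hom f) c) (stalkAlgebraMap_comp_locHomAt t ht hF)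
  simpa only [CommRingCat.hom_comp, CommRingCat.hom_ofHom, RingHom.comp_apply] using h

omit [IsLocalRing R] in
/-- **The `K`-structure clause, backward:** for a `K`-algebra map `φ : 𝒪_{X,x} → R`, the point
`Spec R → Spec 𝒪_{X,x} → X` lies over `K`. [cite: GortzWedhorn2020, (6.4) Prop. 6.7 and Exercise 3.18] -/
theorem specPtAt_comp_eq (φ : X.presheaf.stalk x →+* R) (hφ : φ.comp (stalkAlgebraMap F x) = algebraMap K R) :
    (Spec.map (CommRingCat.ofHom φ) ≫ X.fromSpecStalk x) ≫ F =
      Spec.map (CommRingCat.ofHom (algebraMap K R)) := by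
  rw [Category.assoc, ← Spec_map_stalkAlgebraMap, ← Spec.map_comp, ← CommRingCat.ofHom_comp, hφ]

variable (F x R)

/-- **The functor of points of the pointed `K`-scheme `(X, x)` on local `K`-algebras is `h_{𝒪_{X,x}}`:**
`R`-points through `x` over `K` ≃ local `K`-algebra maps `𝒪_{X,x} → R` (`t ↦` its local homomorphism,
`φ ↦ Spec φ ≫ (Spec 𝒪_{X,x} → X)`). [cite: GortzWedhorn2020, (6.4) Prop. 6.7 and Exercise 3.18] -/
def pointsOverAtEquiv : PointsOverAt F x R ≃ LocAlgHomAt F x R :=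
  letI := (stalkAlgebraMap F x).toAlgebra
  { toFun := fun t =>
      ⟨{ toRingHom := ((X.presheaf.stalkCongr (.of_eq t.2.1)).inv ≫ Scheme.stalkClosedPointTo t.1).hom
         commutes' := fun c => locHomAt_stalkAlgebraMap t.1 t.2.1 t.2.2 c },
        isLocalHom_locHomAt t.1 t.2.1⟩
    invFun := fun φ =>
      haveI : IsLocalHom (CommRingCat.ofHom φ.1.toRingHom).hom := φ.2
      ⟨Spec.map (CommRingCat.ofHom φ.1.toRingHom) ≫ X.fromSpecStalk x, specPtAt_closedPoint _,
        specPtAt_comp_eq φ.1.toRingHom φ.1.comp_algebraMap⟩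
    left_inv := fun t => Subtype.ext (specPtAt_locHomAt t.1 t.2.1)
    right_inv := fun φ => by
      haveI : IsLocalHom (CommRingCat.ofHom φ.1.toRingHom).hom := φ.2
      refine Subtype.ext (AlgHom.ext fun a => ?_)
      exact congrArg (fun f => (CommRingCat.Hom.hom f) a)
        (locHomAt_specPtAt (CommRingCat.ofHom φ.1.toRingHom) (specPtAt_closedPoint _)) }

/-! ## §3 Naturality -/

section NaturalityR

variable {S : Type u} [CommRing S] [IsLocalRing S] [Algebra K S] (ψ : R →ₐ[K] S) [IsLocalHom (ψ : R →+* S)]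

/-- Functoriality of `PointsOverAt` in LOCAL `K`-algebra maps `ψ : R → S`: `t ↦ Spec ψ ≫ t`.
[cite: GortzWedhorn2020, (6.4) Prop. 6.7 and Exercise 3.18] -/
def PointsOverAt.map (t : PointsOverAt F x R) : PointsOverAt F x S :=
  ⟨Spec.map (CommRingCat.ofHom (ψ : R →+* S)) ≫ t.1, by
    haveI : IsLocalHom (CommRingCat.ofHom (ψ : R →+* S)).hom := ‹IsLocalHom (ψ : R →+* S)›
    rw [Scheme.Hom.comp_base, TopCat.coe_comp, Function.comp_apply, Spec_closedPoint, t.2.1], by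
    rw [Category.assoc, t.2.2, ← Spec.map_comp, ← CommRingCat.ofHom_comp, AlgHom.comp_algebraMap]⟩

/-- Unfolding lemma for `PointsOverAt.map`. [cite: GortzWedhorn2020, (6.4) Prop. 6.7 and Exercise 3.18] -/
theorem PointsOverAt.map_coe (t : PointsOverAt F x R) :
    (PointsOverAt.map F x R ψ t).1 = Spec.map (CommRingCat.ofHom (ψ : R →+* S)) ≫ t.1 := rfl

/-- **Naturality in `R`** of `pointsOverAtEquiv`: the local homomorphism of `Spec ψ ≫ t` is `ψ ∘` (that of `t`).
[cite: GortzWedhorn2020, (6.4) Prop. 6.7 and Exercise 3.18] -/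
theorem pointsOverAtEquiv_map (t : PointsOverAt F x R) :
    letI := (stalkAlgebraMap F x).toAlgebra
    ((pointsOverAtEquiv F x S (PointsOverAt.map F x R ψ t)).1 : X.presheaf.stalk x →+* S) =
      (ψ : R →+* S).comp (pointsOverAtEquiv F x R t).1 := by
  letI := (stalkAlgebraMap F x).toAlgebra
  haveI : IsLocalHom (CommRingCat.ofHom (ψ : R →+* S)).hom := ‹IsLocalHom (ψ : R →+* S)›
  exact congrArg CommRingCat.Hom.hom
    (locHomAt_SpecMap_comp (CommRingCat.ofHom (ψ : R →+* S)) t.1 t.2.1 (PointsOverAt.map F x R ψ t).2.1)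

end NaturalityR

section NaturalityX

variable {F x R} (g : X ⟶ Y) (G : Y ⟶ Spec (.of K)) (hg : g ≫ G = F)

include hg in
/-- The stalk map of a `K`-morphism is compatible with the structure maps:
`(𝒪_{Y,g x} → 𝒪_{X,x}) ∘ (K → 𝒪_{Y, g x}) = (K → 𝒪_{X,x})`. [cite: GortzWedhorn2020, (3.4) and Exercise 3.18] -/
theorem stalkMap_comp_stalkAlgebraMap :
    (g.stalkMap x).hom.comp (stalkAlgebraMap G (g.base x)) = stalkAlgebraMap F x := by
  subst hg
  ext c
  simp only [stalkAlgebraMap, RingHom.comp_apply]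
  rw [← CommRingCat.comp_apply, Scheme.Hom.germ_stalkMap, CommRingCat.comp_apply, Scheme.Hom.comp_appTop,
    CommRingCat.comp_apply]
  rfl

include hg in
/-- Functoriality of `PointsOverAt` in pointed `K`-morphisms `g : X → Y`: `t ↦ t ≫ g` is a point of `Y` through
`g x` over `K`. [cite: GortzWedhorn2020, (6.4) Prop. 6.7 and Exercise 3.18] -/
def PointsOverAt.push (t : PointsOverAt F x R) : PointsOverAt G (g.base x) R :=
  ⟨t.1 ≫ g, by rw [Scheme.Hom.comp_base, TopCat.coe_comp, Function.comp_apply, t.2.1], by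
    rw [Category.assoc, hg, t.2.2]⟩

/-- Unfolding lemma for `PointsOverAt.push`. [cite: GortzWedhorn2020, (6.4) Prop. 6.7 and Exercise 3.18] -/
theorem PointsOverAt.push_coe (t : PointsOverAt F x R) : (PointsOverAt.push g G hg t).1 = t.1 ≫ g := rfl

/-- The local homomorphism of `t ≫ g` at `g x` is `(𝒪_{Y,g x} → 𝒪_{X,x})` followed by that of `t` at `x`
(Mathlib `Scheme.stalkClosedPointTo_comp`, transported along `t(𝔪_R) = x`).
[cite: GortzWedhorn2020, (6.4) Prop. 6.7 and Exercise 3.18] -/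
theorem locHomAt_comp_right (t : Spec (.of R) ⟶ X) (ht : t.base (closedPoint R) = x)
    (ht' : (t ≫ g).base (closedPoint R) = g.base x) :
    (Y.presheaf.stalkCongr (.of_eq ht')).inv ≫ Scheme.stalkClosedPointTo (t ≫ g) =
      g.stalkMap x ≫ (X.presheaf.stalkCongr (.of_eq ht)).inv ≫ Scheme.stalkClosedPointTo t := by
  subst ht
  rw [Scheme.stalkClosedPointTo_comp]
  apply TopCat.Presheaf.stalk_hom_ext
  intro U hU
  rw [TopCat.Presheaf.stalkCongr_inv, TopCat.Presheaf.stalkCongr_inv, TopCat.Presheaf.germ_stalkSpecializes_assoc,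
    Scheme.Hom.germ_stalkMap_assoc]
  erw [Scheme.Hom.germ_stalkMap_assoc g U (t.base (closedPoint R)) hU]
  simp only [TopCat.Presheaf.germ_stalkSpecializes_assoc]

/-- **Naturality in pointed `K`-morphisms** of `pointsOverAtEquiv`: the local `K`-algebra map of `t ≫ g` at `g x` is
(that of `t` at `x`) `∘ (𝒪_{Y,g x} → 𝒪_{X,x})`. [cite: GortzWedhorn2020, (6.4) Prop. 6.7 and Exercise 3.18] -/
theorem pointsOverAtEquiv_push (t : PointsOverAt F x R) :
    letI := (stalkAlgebraMap F x).toAlgebra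
    letI := (stalkAlgebraMap G (g.base x)).toAlgebra
    ((pointsOverAtEquiv G (g.base x) R (PointsOverAt.push g G hg t)).1 : Y.presheaf.stalk (g.base x) →+* R) =
      ((pointsOverAtEquiv F x R t).1 : X.presheaf.stalk x →+* R).comp (g.stalkMap x).hom :=
  congrArg CommRingCat.Hom.hom (locHomAt_comp_right g t.1 t.2.1 (PointsOverAt.push g G hg t).2.1)

end NaturalityX

/-! ## §4 Augmentations of local `K`-algebras -/

section Augmentation

variable {A : Type u} [CommRing A] [IsLocalRing A] [Algebra K A]

/-- **A local `K`-algebra has at most one augmentation**: two `K`-algebra maps `A → K` agree (both have kernel `𝔪_A`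
and `A = K + 𝔪_A`; the tree's `ArtAlg.algHom_residueField_unique` is the Artinian case). [cite: StacksProject, Tag 06GC] -/
theorem augmentation_unique (π₁ π₂ : A →ₐ[K] K) : π₁ = π₂ := by
  refine AlgHom.ext fun a => ?_
  have hm : a - algebraMap K A (π₁ a) ∈ RingHom.ker π₂ := by
    rw [TangentHom.ker_eq_maximalIdeal π₂, ← TangentHom.ker_eq_maximalIdeal π₁, RingHom.mem_ker, map_sub,
      AlgHom.commutes, Algebra.algebraMap_self, RingHom.id_apply, sub_self]
  rw [RingHom.mem_ker, map_sub, AlgHom.commutes, Algebra.algebraMap_self, RingHom.id_apply, sub_eq_zero] at hm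
  exact hm.symm

variable {B : Type u} [CommRing B] [IsLocalRing B] [Algebra K B]

/-- **Automatic locality**: a `K`-algebra map `φ : A → B` between local `K`-algebras is local as soon as `B` has an
augmentation `ρ : B → K` (then `ρ ∘ φ` is the augmentation of `A`, whose kernel is `𝔪_A`; «morphisms of `Art_k` are
automatically local»). [cite: FantechiManetti1999T1Lifting, p. 1] [cite: Schlessinger1968, §1] -/
theorem isLocalHom_of_augmentation (ρ : B →ₐ[K] K) (φ : A →ₐ[K] B) : IsLocalHom φ.toRingHom := by
  refine ⟨fun a ha => ?_⟩
  by_contra hna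
  have hmem : a ∈ RingHom.ker (ρ.comp φ) := by
    rw [TangentHom.ker_eq_maximalIdeal]
    exact (IsLocalRing.mem_maximalIdeal a).2 hna
  have hφa : φ a ∈ maximalIdeal B := by
    rw [← TangentHom.ker_eq_maximalIdeal ρ, RingHom.mem_ker]
    simpa only [RingHom.mem_ker, AlgHom.comp_apply] using hmem
  exact (IsLocalRing.mem_maximalIdeal _).1 hφa ha

end Augmentation

/-! ## §5 `K[ε]`-points through a rational point = the tangent space `(𝔪_x/𝔪_x²)^∨` -/

section DualNumbers

open scoped DualNumber
open TrivSqZeroExt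
/-- **`K[ε]`-valued local `K`-algebra maps out of `𝒪_{X,x}` are exactly the tangent vectors of the augmented algebra
`(𝒪_{X,x}, π)`** for the (unique) augmentation `π` of a `K`-rational point: locality is automatic
(`isLocalHom_of_augmentation` with `fst : K[ε] → K`) and `fst ∘ φ = π` by `augmentation_unique`.
[cite: GortzWedhorn2020, (6.4) Prop. 6.7] [cite: Mazur1997Deformation, §15] -/
def locAlgHomAtDualNumberEquivTangentHom
    (π : letI := (stalkAlgebraMap F x).toAlgebra; X.presheaf.stalk x →ₐ[K] K) :
    letI := (stalkAlgebraMap F x).toAlgebra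
    LocAlgHomAt F x K[ε] ≃ TangentHom π :=
  letI := (stalkAlgebraMap F x).toAlgebra
  { toFun := fun φ => ⟨φ.1, fun a => DFunLike.congr_fun (augmentation_unique ((fstHom K K K).comp φ.1) π) a⟩
    invFun := fun ψ => ⟨ψ.1, isLocalHom_of_augmentation (fstHom K K K) ψ.1⟩
    left_inv := fun _ => rfl
    right_inv := fun _ => rfl }

/-- **The tangent space as `K[ε]`-points (Görtz–Wedhorn I (6.4), Prop. 6.7):** for a `K`-scheme `X` and a
`K`-RATIONAL point `x` (witnessed by an augmentation `π : 𝒪_{X,x} → K` of `K`-algebras), the `K[ε]`-points of `X`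
through `x` over `K` are in canonical bijection with the dual of the cotangent space `𝔪_x/𝔪_x²`:
`t ↦ (s̄ ↦ ε`-part of the local homomorphism of `t` at `s)`.
[cite: GortzWedhorn2020, (6.4) Prop. 6.7] [cite: Mazur1997Deformation, §15] -/
def dualNumberPointsOverAtEquivDual
    (π : letI := (stalkAlgebraMap F x).toAlgebra; X.presheaf.stalk x →ₐ[K] K) :
    letI := (stalkAlgebraMap F x).toAlgebra
    PointsOverAt F x K[ε] ≃ Module.Dual K (CotangentSpace (X.presheaf.stalk x)) :=
  letI := (stalkAlgebraMap F x).toAlgebra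
  (pointsOverAtEquiv F x K[ε]).trans <| (locAlgHomAtDualNumberEquivTangentHom F x π).trans <|
    TangentHom.equivDual.trans
      ((Ideal.Cotangent.equivOfEq _ _ (TangentHom.ker_eq_maximalIdeal π)).restrictScalars K).symm.dualMap.toEquiv

/-- The value of `dualNumberPointsOverAtEquivDual` on the class of `s ∈ 𝔪_x` is the `ε`-part of the local
homomorphism of the point at `s`. [cite: GortzWedhorn2020, (6.4) Prop. 6.7] -/
theorem dualNumberPointsOverAtEquivDual_apply_toCotangent
    (π : letI := (stalkAlgebraMap F x).toAlgebra; X.presheaf.stalk x →ₐ[K] K)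
    (t : PointsOverAt F x K[ε]) (s : ↥(maximalIdeal (X.presheaf.stalk x))) :
    letI := (stalkAlgebraMap F x).toAlgebra
    dualNumberPointsOverAtEquivDual F x π t ((maximalIdeal _).toCotangent s) =
      (((X.presheaf.stalkCongr (.of_eq t.2.1)).inv ≫ Scheme.stalkClosedPointTo t.1) (s : X.presheaf.stalk x)).snd :=
  rfl

end DualNumbers

/-! ## §6 As functors of Artin rings: `(X, x)`'s functor of points on `Art_K` is `h_{𝒪_{X,x}}` -/

section ArtinRings

/-- With an augmentation `ρ : R → K` every `K`-algebra map `𝒪_{X,x} → R` is local, so `LocAlgHomAt F x R` is ALL of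
`Hom_K(𝒪_{X,x}, R)`. [cite: GortzWedhorn2020, (6.4) Prop. 6.7] [cite: Schlessinger1968, §2 (`h_R`)] -/
def locAlgHomAtEquivOfAugmentation (ρ : R →ₐ[K] K) :
    letI := (stalkAlgebraMap F x).toAlgebra
    LocAlgHomAt F x R ≃ (X.presheaf.stalk x →ₐ[K] R) :=
  letI := (stalkAlgebraMap F x).toAlgebra
  { toFun := fun φ => φ.1
    invFun := fun φ => ⟨φ, isLocalHom_of_augmentation ρ φ⟩
    left_inv := fun _ => rfl
    right_inv := fun _ => rfl }

/-- **The functor of points of the pointed `K`-scheme `(X, x)` on `Art_K`**: `A ↦ {t : Spec A → X over K through x}`,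
`φ ↦ (t ↦ Spec φ ≫ t)` (maps of `Art_K` are local: `isLocalHom_of_augmentation`).
[cite: Schlessinger1968, §2 (`h_R`)] [cite: GortzWedhorn2020, (6.4) Prop. 6.7] -/
def pointedSchemeFunctor : ArtinFunctor.{u} K where
  obj A := PointsOverAt F x A
  map {A B} φ t :=
    haveI : IsLocalHom (φ : (A : Type u) →+* B) :=
      isLocalHom_of_augmentation (Classical.choice B.exists_augmentation) φ
    PointsOverAt.map F x A φ t
  map_id {A} t := by
    refine Subtype.ext ?_
    change Spec.map (CommRingCat.ofHom ((AlgHom.id K (A : Type u)) : (A : Type u) →+* A)) ≫ t.1 = t.1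
    rw [AlgHom.id_toRingHom, CommRingCat.ofHom_id]
    erw [Spec.map_id]
    exact Category.id_comp _
  map_comp {A B C} φ ψ t := by
    refine Subtype.ext ?_
    change Spec.map (CommRingCat.ofHom ((ψ.comp φ : (A : Type u) →ₐ[K] C) : (A : Type u) →+* C)) ≫ t.1 =
      Spec.map (CommRingCat.ofHom (ψ : (B : Type u) →+* C)) ≫ Spec.map (CommRingCat.ofHom (φ : (A : Type u) →+* B)) ≫ t.1
    rw [AlgHom.comp_toRingHom, CommRingCat.ofHom_comp, Spec.map_comp, Category.assoc]

/-- The components `t ↦ (local `K`-algebra map of t)` of the comparison `(X, x)`'s functor of points `→ h_{𝒪_{X,x}}`.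
[cite: Schlessinger1968, §2 (`h_R`)] [cite: GortzWedhorn2020, (6.4) Prop. 6.7] -/
def pointedSchemeFunctorToPoints (A : ArtAlg.{u} K) :
    letI := (stalkAlgebraMap F x).toAlgebra
    (pointedSchemeFunctor F x).obj A → (ArtinFunctor.points (k := K) (X.presheaf.stalk x)).obj A :=
  letI := (stalkAlgebraMap F x).toAlgebra
  fun t => (pointsOverAtEquiv F x A t).1

/-- **`(X, x)`'s functor of points on `Art_K` IS `h_{𝒪_{X,x}}`, I: each component is a bijection.**
[cite: Schlessinger1968, §2 (`h_R`)] [cite: GortzWedhorn2020, (6.4) Prop. 6.7] -/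
theorem pointedSchemeFunctorToPoints_bijective (A : ArtAlg.{u} K) :
    letI := (stalkAlgebraMap F x).toAlgebra
    Function.Bijective (pointedSchemeFunctorToPoints F x A) :=
  letI := (stalkAlgebraMap F x).toAlgebra
  ((pointsOverAtEquiv F x A).trans
    (locAlgHomAtEquivOfAugmentation F x A (Classical.choice A.exists_augmentation))).bijective

/-- **`(X, x)`'s functor of points on `Art_K` IS `h_{𝒪_{X,x}}`, II: the comparison is a morphism of functors of Artin
rings** ([Manetti1999DeformationTheoryDGLA, Def. 2.7] naturality). [cite: Schlessinger1968, §2 (`h_R`)] [cite: GortzWedhorn2020, (6.4) Prop. 6.7] -/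
theorem isNatural_pointedSchemeFunctorToPoints :
    letI := (stalkAlgebraMap F x).toAlgebra
    (pointedSchemeFunctor F x).IsNatural (ArtinFunctor.points (k := K) (X.presheaf.stalk x))
      (pointedSchemeFunctorToPoints F x) := by
  letI := (stalkAlgebraMap F x).toAlgebra
  intro A B φ t
  haveI : IsLocalHom (φ : (A : Type u) →+* B) :=
    isLocalHom_of_augmentation (Classical.choice B.exists_augmentation) φ
  refine AlgHom.ext fun a => ?_
  have h := pointsOverAtEquiv_map F x A (S := B) φ t
  exact DFunLike.congr_fun h a

end ArtinRings

end Literature.AlgebraicGeometry.Deformation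

end
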